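import Summits.ResolutionOfSingularities.ResolutionOfSingularities.Theorems.PurelyInseparableDim4AtlasReadingStep
import Summits.ResolutionOfSingularities.ResolutionOfSingularities.Theorems.PurelyInseparableDim4AtlasChildFormat
import Summits.ResolutionOfSingularities.ResolutionOfSingularities.Theorems.PurelyInseparableDim4AtlasSurvival
import Summits.ResolutionOfSingularities.ResolutionOfSingularities.Theorems.PurelyInseparableDim4JointHereditaryHostStep
import HarnessLib

/-!
# Purely inseparable four-folds: the HOST STEP and the NODE STEP for atlas members — blow up one member, every entry of every reading
# becomes an atlas member of the new stage; collect children and survivors (brick S3 (c) v4, tranche 1, bricks A3/A4; cell `res-dim4-pi`)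

[OURS · counted 0] (D-0157 DOOR 2; host item stmt-ResolutionOfSingularities-16155, helper). Nothing here proves resolution of
singularities in dimension ≥ 4 / characteristic `p`. (`res-dim4-typ-3/S3c-V4-ATLAS-MEMBERS-DESIGN.md` §2 A3/A4.)

HOST STEP (62's `memberDataH_host_step` for ATLAS MEMBERS): for `c` carrying `MemberDataAT` (DefsThree) with readings `R`, blow up `𝓘(c)`.
For every reading `r ∈ R` the comparison with the model blow-up of `V(z, x_{T_r})` over `r`'s zigzag
(`ChartDictionary.exists_iso_restrict_blowup_zigzag`) feeds the reading step (A3-reading) with `BlockA` at `r`: every entry `e ∈ plan r`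
yields a child `kid r e` carrying `MemberDataAT` for the transformed marked ideal with the readings
`insert (mainReading r e) (image (extraReading r e) (T_r ∖ S″_e))` (basics of the child states: v3's step lemmas / A1b; format invariant:
A3-format; blocks and accessibility inherited along `AEdge`); children are pairwise disjoint (same reading: A3-siblings; different readings:
they lie over the disjoint OWNED parts); every closed order-`p` point over `c` lies on a child or is a leaf point with its point chart; the
leaf points are finitely many.

NODE STEP (64's `joint_hereditary_node_step` for ATLAS MEMBERS, no waiting): a node = pairwise disjoint closed members `cms`, each with
`MemberDataAT` for its reading set `Rd c`. Blowing up `c₁ ∈ cms`: the new members are the children of `c₁` (host step) and the preimages of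
the other members (A2 `memberDataAT_survival`), pairwise disjoint, each with `MemberDataAT`; TERMINATION BOOKKEEPING: the multiset of
reading sets changes by removing `Rd c₁` and adding the children's reading sets, each NON-EMPTY and made of `AEdge`-successors of ONE
reading of `Rd c₁`; every closed order-`p` point over `c₁` is on a new member or is a leaf point (with its point chart); survivors cover;
the leaf points are finitely many.

* **`memberDataAT_host_step`** (A3), **`atlas_node_step`** (A4). AI-produced formalisation, weaker than expert review.
bears_on: LADDER-RESOLUTION:D157-DOOR2 (res-dim4-pi · S3 (c) v4 A3/A4).
-/

set_option linter.dupNamespace false -- D-0017: single-problem summit path `Summit.<S>.<S>.…` by design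

noncomputable section

open MvPolynomial Finset CategoryTheory AlgebraicGeometry Opposite TopologicalSpace
open AlgebraicGeometry.Scheme.IdealSheafData (ofIdealTop vanishingIdeal)

namespace Summit.ResolutionOfSingularities.ResolutionOfSingularities.Theorems.PIDim4

open Literature.AlgebraicGeometry.Resolution
open Literature.AlgebraicGeometry.Resolution.Hauser2010
open Literature.AlgebraicGeometry.Resolution.AffinePointBlowup (P A γ coord Wtop ξ)

namespace Equimultiple

section HostStepAT

variable {K : Type} [Field K] {p : ℕ} [hp : Fact p.Prime] [CharP K p] [DecidableEq K]
variable {X' : Scheme.{0}}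

/-- **THE HOST STEP OF AN ATLAS MEMBER (A3).** See the module docstring. [cite: BierstoneGrigorievMilmanWlodarczyk2011, Def. 3.1.3;
§4 Step 2b] [cite: Hauser2010, §§F–G] -/
theorem memberDataAT_host_step [IsAlgClosed K] [IsLocallyNoetherian X'] [DecidableEq (AReading K)] (M' : MarkedIdeal X')
    (hmult : M'.mult = p) (plan : AReading K → Finset (Fin 4 × (Fin 4 → K) × Finset (Fin 4)))
    (leaves : AReading K → Finset (Fin 4 × (Fin 4 → K))) (c : Closeds X') {R : Finset (AReading K)}
    (h : MemberDataAT p plan leaves M' c R) :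
    ∃ kid : AReading K → Fin 4 × (Fin 4 → K) × Finset (Fin 4) → Closeds (blowup (vanishingIdeal c)),
      (∀ r ∈ R, ∀ e ∈ plan r,
        MemberDataAT p plan leaves (M'.transform (blowup.π (vanishingIdeal c)) (vanishingIdeal c)) (kid r e)
            (insert (mainReading p r e) ((r.2.1 \ e.2.2).image fun l => extraReading p r e l)) ∧
          (kid r e : Set (blowup (vanishingIdeal c))) ⊆ blowup.π (vanishingIdeal c) ⁻¹' (c : Set X') ∧
          (kid r e : Set (blowup (vanishingIdeal c))).Nonempty) ∧
      (∀ r ∈ R, ∀ e ∈ plan r, ∀ r' ∈ R, ∀ e' ∈ plan r', (r, e) ≠ (r', e') →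
        Disjoint (kid r e : Set (blowup (vanishingIdeal c))) (kid r' e' : Set (blowup (vanishingIdeal c)))) ∧
      (∀ w : blowup (vanishingIdeal c), IsClosed ({w} : Set (blowup (vanishingIdeal c))) →
        blowup.π (vanishingIdeal c) w ∈ (c : Set X') →
        (p : ℕ∞) ≤ idealOrder (M'.transform (blowup.π (vanishingIdeal c)) (vanishingIdeal c)).ideal w →
        (∃ r ∈ R, ∃ e ∈ plan r, w ∈ (kid r e : Set (blowup (vanishingIdeal c)))) ∨
        ∃ r ∈ R, ∃ l ∈ leaves r, l.1 ∈ r.2.1 ∧ l.2 l.1 = 0 ∧ CentreBlowup.IsEquimultiplePoint p r.2.1 l.1 l.2 r.1 ∧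
          ∃ (Y' : Scheme.{0}) (φ' : Y' ⟶ blowup (vanishingIdeal c)) (ψ' : Y' ⟶ P 4 K) (_ : IsOpenImmersion φ')
            (_ : IsOpenImmersion ψ') (y' : Y'), φ' y' = w ∧ ψ' y' = ξ 4 K ∧
            (M'.transform (blowup.π (vanishingIdeal c)) (vanishingIdeal c)).ideal.comap φ' =
              (hypSheaf p (CentreBlowup.step p r.2.1 l.1 l.2 r.1).F).comap ψ') ∧
      {w : blowup (vanishingIdeal c) | IsClosed ({w} : Set (blowup (vanishingIdeal c))) ∧
        blowup.π (vanishingIdeal c) w ∈ (c : Set X') ∧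
        (p : ℕ∞) ≤ idealOrder (M'.transform (blowup.π (vanishingIdeal c)) (vanishingIdeal c)).ideal w ∧
        ∀ r ∈ R, ∀ e ∈ plan r, w ∉ (kid r e : Set (blowup (vanishingIdeal c)))}.Finite := by
  classical
  obtain ⟨hbasic, hfmt, hreg, hsnc, hatlas, hblocks, hacc⟩ := h
  obtain ⟨Yc, φ, ψ, hcl, hcov, hdis⟩ := hatlas
  set Ce : X'.IdealSheafData := vanishingIdeal c with hCe
  have hπ : IsBlowup (blowup.π Ce) Ce := blowup.isBlowup Ce
  haveI : IsProper (blowup.π Ce) := hπ.isProper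
  haveI : IsLocallyNoetherian (blowup Ce) := LocallyOfFiniteType.isLocallyNoetherian (blowup.π Ce)
  -- the reading step at every reading
  have step : ∀ r : ↥R, ∃ kid : Fin 4 × (Fin 4 → K) × Finset (Fin 4) → Closeds (blowup Ce),
      (∀ e ∈ plan r.1,
        Scheme.IsRegular (vanishingIdeal (kid e)).subscheme ∧
        HasSNCWith (M'.transform (blowup.π Ce) Ce).boundary (vanishingIdeal (kid e)) ∧
        MemberAtlasZF p (M'.transform (blowup.π Ce) Ce) (kid e)
          (insert (mainReading p r.1 e) ((r.1.2.1 \ e.2.2).image fun l => extraReading p r.1 e l)) ∧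
        (kid e : Set (blowup Ce)) ⊆ blowup.π Ce ⁻¹' (φ r '' (ψ r ⁻¹' ownedSetZ r.1.2.1 ((e.2.2 \ r.1.2.1).image fun m => (m, e.2.1 m)))) ∧
        (kid e : Set (blowup Ce)).Nonempty) ∧
      (∀ e ∈ plan r.1, ∀ e' ∈ plan r.1, e ≠ e' → Disjoint (kid e : Set (blowup Ce)) (kid e' : Set (blowup Ce))) ∧
      (∀ w : blowup Ce, IsClosed ({w} : Set (blowup Ce)) → blowup.π Ce w ∈ φ r '' (ψ r ⁻¹' ownedSetZ r.1.2.1 r.1.2.2.1) →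
        (p : ℕ∞) ≤ idealOrder (M'.transform (blowup.π Ce) Ce).ideal w →
        (∃ e ∈ plan r.1, w ∈ (kid e : Set (blowup Ce))) ∨
        ∃ l ∈ leaves r.1, l.1 ∈ r.1.2.1 ∧ l.2 l.1 = 0 ∧ CentreBlowup.IsEquimultiplePoint p r.1.2.1 l.1 l.2 r.1.1 ∧
          ∃ (Y' : Scheme.{0}) (φ' : Y' ⟶ blowup Ce) (ψ' : Y' ⟶ P 4 K) (_ : IsOpenImmersion φ') (_ : IsOpenImmersion ψ') (y' : Y'),
            φ' y' = w ∧ ψ' y' = ξ 4 K ∧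
            (M'.transform (blowup.π Ce) Ce).ideal.comap φ' = (hypSheaf p (CentreBlowup.step p r.1.2.1 l.1 l.2 r.1.1).F).comap ψ') ∧
      {w : blowup Ce | IsClosed ({w} : Set (blowup Ce)) ∧ blowup.π Ce w ∈ φ r '' (ψ r ⁻¹' ownedSetZ r.1.2.1 r.1.2.2.1) ∧
        (p : ℕ∞) ≤ idealOrder (M'.transform (blowup.π Ce) Ce).ideal w ∧ ∀ e ∈ plan r.1, w ∉ (kid e : Set (blowup Ce))}.Finite := by
    intro r
    obtain ⟨hφ, hψ, hM, hZ, hsee, hfib, idx, cst_, hshape, hinj⟩ := hcl r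
    set B := blowup.π (AffineCoordBlowup.𝓘Λ 4 K (insert 0 (Fin.succ '' (r.1.2.1 : Set (Fin 4))))) with hBdef
    have hB : IsBlowup B (AffineCoordBlowup.𝓘Λ 4 K (insert 0 (Fin.succ '' (r.1.2.1 : Set (Fin 4))))) := blowup.isBlowup _
    obtain ⟨ε, hsq, hC', hKEY⟩ := ChartDictionary.exists_iso_restrict_blowup_zigzag (φ r) (ψ r) _ Ce hZ hπ hB
    have hK := hKEY M'.ideal (hypSheaf p r.1.1.F) p hM
    obtain ⟨hF, hclean, hperm⟩ := hbasic r.1 r.2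
    obtain ⟨hX, hDS⟩ := hfmt r.1 r.2
    obtain ⟨hP1, hP2, -, hP5⟩ := hblocks r.1 r.2 r.1 Relation.ReflTransGen.refl
    obtain ⟨kid, Θ, hkid, hkdisj, hkcover, hkfin⟩ :=
      atlas_reading_step (φ r) (ψ r) ε Ce hπ hB hsq hC' M' hmult r.1.1 hF hclean hK hperm.2 hsee hsnc idx cst_ hshape hinj
        r.1.2.2.1 r.1.2.2.2 hX hDS hfib (plan r.1) hP1 hP2 (leaves r.1) hP5
    refine ⟨kid, fun e he => ?_, hkdisj, hkcover, hkfin⟩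
    obtain ⟨-, -, -, -, -, hover, hne, hregk, hsnck, hatk⟩ := hkid e he
    exact ⟨hregk, hsnck, hatk, hover, hne⟩
  choose kid hkid hkdisj hkcover hkfin using step
  -- owned parts: a child lies over the owned part of its reading
  have hownsub : ∀ (r : ↥R) (e : Fin 4 × (Fin 4 → K) × Finset (Fin 4)), e ∈ plan r.1 →
      ownedSetZ r.1.2.1 ((e.2.2 \ r.1.2.1).image fun m => (m, e.2.1 m)) ⊆ ownedSetZ r.1.2.1 r.1.2.2.1 := by
    intro r e he x hx
    obtain ⟨-, -, -, hD, hown, -⟩ := (hblocks r.1 r.2 r.1 Relation.ReflTransGen.refl).1 e he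
    obtain ⟨hX, hDS⟩ := hfmt r.1 r.2
    rw [ownedSetZ_image_eq] at hx
    refine ⟨hx.1, fun iv hiv => ?_⟩
    have h1 := hx.2 iv.1 (Finset.mem_sdiff.mpr ⟨hD (hX iv hiv), hDS iv.1 (hX iv hiv)⟩)
    rwa [hown iv hiv] at h1
  have hkover : ∀ (r : ↥R) (e : Fin 4 × (Fin 4 → K) × Finset (Fin 4)), e ∈ plan r.1 →
      (kid r e : Set (blowup Ce)) ⊆ blowup.π Ce ⁻¹' (φ r '' (ψ r ⁻¹' ownedSetZ r.1.2.1 r.1.2.2.1)) := fun r e he w hw =>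
    Set.preimage_mono (Set.image_mono (Set.preimage_mono (hownsub r e he))) ((hkid r e he).2.2.2.1 hw)
  have hownc : ∀ r : ↥R, φ r '' (ψ r ⁻¹' ownedSetZ r.1.2.1 r.1.2.2.1) ⊆ (c : Set X') := fun r => by
    obtain ⟨-, -, -, hZ, -⟩ := hcl r
    exact image_preimage_subset_member (φ r) (ψ r) c hZ fun x hx => by
      simp only [ownedSetZ, Set.mem_setOf_eq] at hx; exact hx.1
  -- the children, indexed by readings of `R`
  let kid' : AReading K → Fin 4 × (Fin 4 → K) × Finset (Fin 4) → Closeds (blowup Ce) := fun r e =>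
    if hr : r ∈ R then kid ⟨r, hr⟩ e else ⊥
  have hkid' : ∀ r (hr : r ∈ R) e, kid' r e = kid ⟨r, hr⟩ e := fun r hr e => by simp only [kid', dif_pos hr]
  refine ⟨kid', fun r hr e he => ?_, fun r hr e he r' hr' e' he' hne => ?_, fun w hw hwc hord => ?_, ?_⟩
  · -- every child is an atlas member of the new stage
    rw [hkid' r hr]
    obtain ⟨hregk, hsnck, hatk, hover, hne⟩ := hkid ⟨r, hr⟩ e he
    obtain ⟨hF, hclean, hperm⟩ := hbasic r hr
    obtain ⟨hX, hDS⟩ := hfmt r hr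
    obtain ⟨hj, hbj, hjS'', hD, hown, heq, hperm', hesc⟩ := (hblocks r hr r Relation.ReflTransGen.refl).1 e he
    refine ⟨⟨fun r' hr' => ?_, fun r' hr' => ?_, hregk, hsnck, hatk, fun r' hr' q hq => ?_, fun r' hr' => ?_⟩,
      fun w hw => hownc ⟨r, hr⟩ (hkover ⟨r, hr⟩ e he hw), hne⟩
    · -- basics of the child's readings
      rcases Finset.mem_insert.mp hr' with rfl | hr'
      · exact ⟨step_F_ne_zero_of_isClean hj e.2.1 r.1 hF hclean hperm.2, isClean_step r.2.1 e.1 e.2.1 r.1, hperm'⟩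
      · obtain ⟨l, hl, rfl⟩ := Finset.mem_image.mp hr'
        obtain ⟨hlS, hlS''⟩ := Finset.mem_sdiff.mp hl
        have hE : IsEscaping r.2.1 e := fun hsub => hlS'' (hsub hlS)
        obtain ⟨hbS, hpermE⟩ := hesc hE
        obtain ⟨Θⱼ, -, -, -, -, ⟨-, -, -, -, -⟩, -, hrest⟩ :=
          globalCentre_atlas_package_linearEscaping
            (π := blowup.π (AffineCoordBlowup.𝓘Λ 4 K (insert 0 (Fin.succ '' (r.2.1 : Set (Fin 4))))))
            hj hjS'' hbS r.1 hF hclean hperm.2 (blowup.isBlowup _) hperm'.2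
            [] [] 0 0 (fun _ _ => rfl) (fun i hi => absurd hi (List.not_mem_nil)) (fun i hi => absurd hi (List.not_mem_nil))
        obtain ⟨Θ', g', -, -, -, -, -, hneF, hcl', -, -⟩ := hrest l hlS hlS''
        exact ⟨hneF, hcl', hpermE l hl⟩
    · -- the format invariant
      rcases Finset.mem_insert.mp hr' with rfl | hr'
      · exact mainReading_format p r e hX hD
      · obtain ⟨l, hl, rfl⟩ := Finset.mem_image.mp hr'
        exact extraReading_format p r e hX hD hDS hj hjS'' hl
    · -- blocks along `AEdge`
      rcases Finset.mem_insert.mp hr' with rfl | hr'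
      · exact hblocks r hr q (Relation.ReflTransGen.head (aedge_mainReading p plan r he) hq)
      · obtain ⟨l, hl, rfl⟩ := Finset.mem_image.mp hr'
        exact hblocks r hr q (Relation.ReflTransGen.head (aedge_extraReading p plan r he hl) hq)
    · -- accessibility
      rcases Finset.mem_insert.mp hr' with rfl | hr'
      · exact (hacc r hr).inv (aedge_mainReading p plan r he)
      · obtain ⟨l, hl, rfl⟩ := Finset.mem_image.mp hr'
        exact (hacc r hr).inv (aedge_extraReading p plan r he hl)
  · -- pairwise disjointness
    rw [hkid' r hr, hkid' r' hr']
    by_cases hrr : r = r'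
    · subst hrr
      have hee : e ≠ e' := fun h => hne (by rw [h])
      exact hkdisj ⟨r, hr⟩ e he e' he' hee
    · have hne' : (⟨r, hr⟩ : ↥R) ≠ ⟨r', hr'⟩ := fun h => hrr (Subtype.ext_iff.mp h)
      refine Set.disjoint_left.mpr fun w hw hw' => ?_
      exact Set.disjoint_left.mp (hdis _ _ hne') (hkover ⟨r, hr⟩ e he hw) (hkover ⟨r', hr'⟩ e' he' hw')
  · -- the cover over `c`
    obtain ⟨r, hr⟩ := Set.mem_iUnion.mp (hcov hwc)
    rcases hkcover r w hw hr hord with ⟨e, he, hwe⟩ | ⟨l, hl, hrest⟩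
    · exact Or.inl ⟨r.1, r.2, e, he, by rw [hkid' r.1 r.2]; exact hwe⟩
    · exact Or.inr ⟨r.1, r.2, l, hl, hrest⟩
  · -- finitely many leaf points
    refine (Set.finite_iUnion fun r : ↥R => hkfin r).subset fun w hw => ?_
    obtain ⟨hwcl, hwc, hord, hout⟩ := hw
    obtain ⟨r, hr⟩ := Set.mem_iUnion.mp (hcov hwc)
    exact Set.mem_iUnion.mpr ⟨r, hwcl, hr, hord, fun e he => by rw [← hkid' r.1 r.2]; exact hout r.1 r.2 e he⟩

end HostStepAT

section NodeStepAT

variable {K : Type} [Field K] {p : ℕ} [hp : Fact p.Prime] [CharP K p] [DecidableEq K]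
variable {X' : Scheme.{0}}

/-- **THE NODE STEP FOR ATLAS MEMBERS (A4).** See the module docstring. [cite: BierstoneGrigorievMilmanWlodarczyk2011, Def. 3.1.3]
[cite: Hauser2010, §§F–G] -/
theorem atlas_node_step [IsAlgClosed K] [IsLocallyNoetherian X'] [DecidableEq (AReading K)] (M' : MarkedIdeal X')
    (hmult : M'.mult = p) (plan : AReading K → Finset (Fin 4 × (Fin 4 → K) × Finset (Fin 4)))
    (leaves : AReading K → Finset (Fin 4 × (Fin 4 → K))) (cms : Finset (Closeds X')) (Rd : Closeds X' → Finset (AReading K))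
    (hcdata : ∀ c ∈ cms, MemberDataAT p plan leaves M' c (Rd c))
    (hdisj₁ : ∀ c ∈ cms, ∀ c' ∈ cms, c ≠ c' → Disjoint (c : Set X') (c' : Set X')) {c₁ : Closeds X'} (hc₁ : c₁ ∈ cms) :
    ∃ (cms' : Finset (Closeds (blowup (vanishingIdeal c₁)))) (Rd' : Closeds (blowup (vanishingIdeal c₁)) → Finset (AReading K)),
      (∀ d ∈ cms', MemberDataAT p plan leaves (M'.transform (blowup.π (vanishingIdeal c₁)) (vanishingIdeal c₁)) d (Rd' d)) ∧
      (∀ d ∈ cms', ∀ d' ∈ cms', d ≠ d' →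
        Disjoint (d : Set (blowup (vanishingIdeal c₁))) (d' : Set (blowup (vanishingIdeal c₁)))) ∧
      (∃ KR : Multiset (Finset (AReading K)),
        (∀ R' ∈ KR, R'.Nonempty ∧ ∃ r ∈ Rd c₁, ∀ r' ∈ R', AEdge p plan r' r) ∧
        (∑ d ∈ cms', ({Rd' d} : Multiset (Finset (AReading K)))) + {Rd c₁} =
          (∑ c ∈ cms, ({Rd c} : Multiset (Finset (AReading K)))) + KR) ∧
      (∀ d ∈ cms', ∀ w ∈ (d : Set (blowup (vanishingIdeal c₁))),
        blowup.π (vanishingIdeal c₁) w ∈ (c₁ : Set X') ∨ ∃ c ∈ cms, c ≠ c₁ ∧ blowup.π (vanishingIdeal c₁) w ∈ (c : Set X')) ∧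
      (∀ w : blowup (vanishingIdeal c₁), IsClosed ({w} : Set (blowup (vanishingIdeal c₁))) →
        blowup.π (vanishingIdeal c₁) w ∈ (c₁ : Set X') →
        (p : ℕ∞) ≤ idealOrder (M'.transform (blowup.π (vanishingIdeal c₁)) (vanishingIdeal c₁)).ideal w →
        (∃ d ∈ cms', w ∈ (d : Set (blowup (vanishingIdeal c₁)))) ∨
        ∃ r ∈ Rd c₁, ∃ l ∈ leaves r, l.1 ∈ r.2.1 ∧ l.2 l.1 = 0 ∧ CentreBlowup.IsEquimultiplePoint p r.2.1 l.1 l.2 r.1 ∧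
          ∃ (Y' : Scheme.{0}) (φ' : Y' ⟶ blowup (vanishingIdeal c₁)) (ψ' : Y' ⟶ P 4 K) (_ : IsOpenImmersion φ')
            (_ : IsOpenImmersion ψ') (y' : Y'), φ' y' = w ∧ ψ' y' = ξ 4 K ∧
            (M'.transform (blowup.π (vanishingIdeal c₁)) (vanishingIdeal c₁)).ideal.comap φ' =
              (hypSheaf p (CentreBlowup.step p r.2.1 l.1 l.2 r.1).F).comap ψ') ∧
      (∀ w : blowup (vanishingIdeal c₁), ∀ c ∈ cms, c ≠ c₁ → blowup.π (vanishingIdeal c₁) w ∈ (c : Set X') →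
        ∃ d ∈ cms', w ∈ (d : Set (blowup (vanishingIdeal c₁)))) ∧
      {w : blowup (vanishingIdeal c₁) | IsClosed ({w} : Set (blowup (vanishingIdeal c₁))) ∧
        blowup.π (vanishingIdeal c₁) w ∈ (c₁ : Set X') ∧
        (p : ℕ∞) ≤ idealOrder (M'.transform (blowup.π (vanishingIdeal c₁)) (vanishingIdeal c₁)).ideal w ∧
        ∀ d ∈ cms', w ∉ (d : Set (blowup (vanishingIdeal c₁)))}.Finite := by
  classical
  obtain ⟨kid, hkid, hkdisj, hkcover, hkfin⟩ := memberDataAT_host_step M' hmult plan leaves c₁ (hcdata c₁ hc₁)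
  have hπ : IsBlowup (blowup.π (vanishingIdeal c₁)) (vanishingIdeal c₁) := blowup.isBlowup _
  haveI : IsProper (blowup.π (vanishingIdeal c₁)) := hπ.isProper
  haveI : IsLocallyNoetherian (blowup (vanishingIdeal c₁)) := LocallyOfFiniteType.isLocallyNoetherian (blowup.π (vanishingIdeal c₁))
  have hCsupp : ((vanishingIdeal c₁).support : Set X') = (c₁ : Set X') := by
    rw [Scheme.IdealSheafData.coe_support_vanishingIdeal]
  have hsncC : HasSNCWith M'.boundary (vanishingIdeal c₁) := (hcdata c₁ hc₁).2.2.2.1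
  -- positions and injectivity of the children
  have hkid_over : ∀ r ∈ Rd c₁, ∀ e ∈ plan r, ∀ w ∈ (kid r e : Set (blowup (vanishingIdeal c₁))),
      blowup.π (vanishingIdeal c₁) w ∈ (c₁ : Set X') := fun r hr e he w hw => (hkid r hr e he).2.1 hw
  have hkid_inj : ∀ r ∈ Rd c₁, ∀ e ∈ plan r, ∀ r' ∈ Rd c₁, ∀ e' ∈ plan r', kid r e = kid r' e' → (r, e) = (r', e') := by
    intro r hr e he r' hr' e' he' hee
    by_contra hne
    obtain ⟨w, hw⟩ := (hkid r hr e he).2.2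
    exact Set.disjoint_left.mp (hkdisj r hr e he r' hr' e' he' hne) hw (by rw [← hee]; exact hw)
  -- survivors
  set prei : Closeds X' → Closeds (blowup (vanishingIdeal c₁)) := fun c => c.preimage (blowup.π (vanishingIdeal c₁)).continuous
    with hprei
  have hne₁ : ∀ c ∈ cms.erase c₁, c ≠ c₁ := fun c hc => Finset.ne_of_mem_erase hc
  have hmem₁ : ∀ c ∈ cms.erase c₁, c ∈ cms := fun c hc => Finset.mem_of_mem_erase hc
  have hdisjC : ∀ c ∈ cms.erase c₁, Disjoint (c : Set X') ((vanishingIdeal c₁).support : Set X') := fun c hc => by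
    rw [hCsupp]; exact hdisj₁ c (hmem₁ c hc) c₁ hc₁ (hne₁ c hc)
  have hprei_inj : Set.InjOn prei ↑(cms.erase c₁) := fun c hc c' hc' hcc => by
    have key : ∀ {d d' : Closeds X'}, d ∈ cms.erase c₁ → prei d = prei d' → (d : Set X') ⊆ (d' : Set X') := by
      intro d d' hd hdd x hx
      obtain ⟨w, hw⟩ := exists_eq_of_not_mem_support hπ (Set.disjoint_left.mp (hdisjC d hd) hx)
      have hw' : w ∈ (prei d : Set (blowup (vanishingIdeal c₁))) := by
        change blowup.π (vanishingIdeal c₁) w ∈ (d : Set X'); rw [hw]; exact hx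
      rw [hdd] at hw'
      change blowup.π (vanishingIdeal c₁) w ∈ (d' : Set X') at hw'
      rwa [hw] at hw'
    exact Closeds.ext (Set.Subset.antisymm (key hc hcc) (key hc' hcc.symm))
  have hkid_ne_prei : ∀ r ∈ Rd c₁, ∀ e ∈ plan r, ∀ c ∈ cms.erase c₁, kid r e ≠ prei c := fun r hr e he c hc hec => by
    obtain ⟨w, hw⟩ := (hkid r hr e he).2.2
    have h1 := hkid_over r hr e he w hw
    rw [hec] at hw
    exact Set.disjoint_left.mp (hdisj₁ c (hmem₁ c hc) c₁ hc₁ (hne₁ c hc)) hw h1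
  -- the new members
  set kidsF : Finset (Closeds (blowup (vanishingIdeal c₁))) := (Rd c₁).biUnion fun r => (plan r).image (kid r) with hkidsF
  set survF : Finset (Closeds (blowup (vanishingIdeal c₁))) := (cms.erase c₁).image prei with hsurvF
  have hmem_kidsF : ∀ d, d ∈ kidsF ↔ ∃ r ∈ Rd c₁, ∃ e ∈ plan r, kid r e = d := fun d => by
    simp only [hkidsF, Finset.mem_biUnion, Finset.mem_image]
  have hdisj_ks : Disjoint kidsF survF := Finset.disjoint_left.mpr fun ⦃d⦄ hd hd' => by
    obtain ⟨r, hr, e, he, rfl⟩ := (hmem_kidsF d).mp hd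
    obtain ⟨c, hc, hce⟩ := Finset.mem_image.mp hd'
    exact hkid_ne_prei r hr e he c hc hce.symm
  set cms' : Finset (Closeds (blowup (vanishingIdeal c₁))) := kidsF.disjUnion survF hdisj_ks with hcms'
  have hmem_cms' : ∀ d, d ∈ cms' ↔ (∃ r ∈ Rd c₁, ∃ e ∈ plan r, kid r e = d) ∨ ∃ c ∈ cms.erase c₁, prei c = d := fun d => by
    rw [hcms', Finset.mem_disjUnion, hmem_kidsF, hsurvF, Finset.mem_image]
  -- the new reading sets
  set Rd' : Closeds (blowup (vanishingIdeal c₁)) → Finset (AReading K) := fun d =>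
    if h : ∃ re : AReading K × (Fin 4 × (Fin 4 → K) × Finset (Fin 4)), re.1 ∈ Rd c₁ ∧ re.2 ∈ plan re.1 ∧ kid re.1 re.2 = d then
      insert (mainReading p h.choose.1 h.choose.2)
        ((h.choose.1.2.1 \ h.choose.2.2.2).image fun l => extraReading p h.choose.1 h.choose.2 l)
    else if h' : ∃ c ∈ cms.erase c₁, prei c = d then Rd h'.choose else ∅ with hRd'
  have hkid_rep : ∀ r ∈ Rd c₁, ∀ e ∈ plan r,
      Rd' (kid r e) = insert (mainReading p r e) ((r.2.1 \ e.2.2).image fun l => extraReading p r e l) := by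
    intro r hr e he
    have h : ∃ re : AReading K × (Fin 4 × (Fin 4 → K) × Finset (Fin 4)), re.1 ∈ Rd c₁ ∧ re.2 ∈ plan re.1 ∧ kid re.1 re.2 = kid r e :=
      ⟨(r, e), hr, he, rfl⟩
    have hch : h.choose = (r, e) :=
      hkid_inj _ h.choose_spec.1 _ h.choose_spec.2.1 r hr e he h.choose_spec.2.2
    simp only [hRd', dif_pos h]
    rw [hch]
  have hsurv_rep : ∀ c ∈ cms.erase c₁, Rd' (prei c) = Rd c := by
    intro c hc
    have hn₀ : ¬ ∃ re : AReading K × (Fin 4 × (Fin 4 → K) × Finset (Fin 4)), re.1 ∈ Rd c₁ ∧ re.2 ∈ plan re.1 ∧ kid re.1 re.2 = prei c :=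
      fun ⟨re, hr, he, hec⟩ => hkid_ne_prei re.1 hr re.2 he c hc hec
    have h' : ∃ c' ∈ cms.erase c₁, prei c' = prei c := ⟨c, hc, rfl⟩
    have hch : h'.choose = c := hprei_inj h'.choose_spec.1 hc h'.choose_spec.2
    simp only [hRd', dif_neg hn₀, dif_pos h']
    rw [hch]
  -- a singleton sum is a map
  have hsum : ∀ {ι : Type} [DecidableEq ι] (A : Finset ι) (f : ι → Finset (AReading K)),
      ∑ a ∈ A, ({f a} : Multiset (Finset (AReading K))) = A.val.map f := by
    intro ι _ A f
    induction A using Finset.induction_on with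
    | empty => rfl
    | insert a A ha ih => rw [Finset.sum_insert ha, ih, Finset.insert_val_of_notMem ha, Multiset.map_cons, Multiset.singleton_add]
  refine ⟨cms', Rd', fun d hd => ?_, fun d hd d' hd' hdd => ?_, ⟨∑ d ∈ kidsF, ({Rd' d} : Multiset (Finset (AReading K))), ?_, ?_⟩,
    fun d hd w hw => ?_, fun w hw hwx hord => ?_, fun w c hc hcc hw => ?_, ?_⟩
  · -- member data: children and survivors
    rcases (hmem_cms' d).mp hd with ⟨r, hr, e, he, rfl⟩ | ⟨c, hc, rfl⟩
    · rw [hkid_rep r hr e he]; exact (hkid r hr e he).1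
    · rw [hsurv_rep c hc]
      exact memberDataAT_survival hπ M' hmult hsncC plan leaves c (hdisjC c hc) (hcdata c (hmem₁ c hc))
  · -- pairwise disjoint
    rcases (hmem_cms' d).mp hd with ⟨r, hr, e, he, rfl⟩ | ⟨c, hc, rfl⟩
    · rcases (hmem_cms' d').mp hd' with ⟨r', hr', e', he', rfl⟩ | ⟨c', hc', rfl⟩
      · exact hkdisj r hr e he r' hr' e' he' fun h => hdd (by rw [(Prod.mk.inj h).1, (Prod.mk.inj h).2])
      · exact Set.disjoint_left.mpr fun w hw hw' =>
          Set.disjoint_left.mp (hdisj₁ c' (hmem₁ c' hc') c₁ hc₁ (hne₁ c' hc')) hw' (hkid_over r hr e he w hw)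
    · rcases (hmem_cms' d').mp hd' with ⟨r', hr', e', he', rfl⟩ | ⟨c', hc', rfl⟩
      · exact Set.disjoint_left.mpr fun w hw hw' =>
          Set.disjoint_left.mp (hdisj₁ c (hmem₁ c hc) c₁ hc₁ (hne₁ c hc)) hw (hkid_over r' hr' e' he' w hw')
      · exact (hdisj₁ c (hmem₁ c hc) c' (hmem₁ c' hc') fun h => hdd (by rw [h])).preimage _
  · -- the children's reading sets: non-empty, successors of one reading
    intro R' hR'
    rw [hsum] at hR'
    obtain ⟨d, hd, rfl⟩ := Multiset.mem_map.mp hR'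
    obtain ⟨r, hr, e, he, rfl⟩ := (hmem_kidsF d).mp (Finset.mem_val.mp hd)
    rw [hkid_rep r hr e he]
    refine ⟨⟨_, Finset.mem_insert_self _ _⟩, r, hr, fun r' hr' => ?_⟩
    rcases Finset.mem_insert.mp hr' with rfl | hr'
    · exact aedge_mainReading p plan r he
    · obtain ⟨l, hl, rfl⟩ := Finset.mem_image.mp hr'
      exact aedge_extraReading p plan r he hl
  · -- the multiset identity
    have hs : ∑ d ∈ survF, ({Rd' d} : Multiset (Finset (AReading K))) =
        ∑ c ∈ cms.erase c₁, ({Rd c} : Multiset (Finset (AReading K))) := by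
      rw [hsurvF, Finset.sum_image hprei_inj]
      exact Finset.sum_congr rfl fun c hc => by rw [hsurv_rep c hc]
    rw [hcms', Finset.sum_disjUnion, hs, ← Finset.add_sum_erase cms _ hc₁]
    abel
  · -- where members sit
    rcases (hmem_cms' d).mp hd with ⟨r, hr, e, he, rfl⟩ | ⟨c, hc, rfl⟩
    · exact Or.inl (hkid_over r hr e he w hw)
    · exact Or.inr ⟨c, hmem₁ c hc, hne₁ c hc, hw⟩
  · -- cover over the host, modulo leaves
    rcases hkcover w hw hwx hord with ⟨r, hr, e, he, hwe⟩ | h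
    · exact Or.inl ⟨kid r e, (hmem_cms' _).mpr (Or.inl ⟨r, hr, e, he, rfl⟩), hwe⟩
    · exact Or.inr h
  · -- survivors cover
    exact ⟨prei c, (hmem_cms' _).mpr (Or.inr ⟨c, Finset.mem_erase.mpr ⟨hcc, hc⟩, rfl⟩), hw⟩
  · -- finiteness of the leaf points
    exact hkfin.subset fun w ⟨hw, hwx, hord, hout⟩ =>
      ⟨hw, hwx, hord, fun r hr e he => hout _ ((hmem_cms' _).mpr (Or.inl ⟨r, hr, e, he, rfl⟩))⟩

end NodeStepAT

end Equimultiple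

end Summit.ResolutionOfSingularities.ResolutionOfSingularities.Theorems.PIDim4

end
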